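import Literature.AlgebraicGeometry.Motives.FrobIntegralPartEqFrobeniusPowerFixed
import Literature.AlgebraicGeometry.Motives.GaloisEquivariancePushforward
import HarnessLib

/-!
# Functoriality of `F^r_b Hⁱ(X)`: pull-backs, cup products with Galois-invariant classes, Gysin
# push-forwards and algebraic correspondences respect the effective-twist part
# (Milne–Ramachandran 2006, §1 Rem. 1.4 and Lemma 1.9)

Topic `Literature/AlgebraicGeometry/Motives`; THEOREMS ONLY (no definition, no instance, no named
fact; D-0026).

J. S. Milne, N. Ramachandran, *Motivic complexes over finite fields and the ring of correspondences at
the generic point*, arXiv:math/0607483 [MilneRamachandran2006] §1 (held text): Rem. 1.4 (chunk p0003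
L77–L88) defines `F^r_b Hⁱ_l(X)` as «the largest semisimple Tate substructure of `Hⁱ_l(X)` whose twist
by `ℚ_l(r)` is still effective»; in the proof of Lemma 1.9 (chunk p0004 L103–L110), for an algebraic
correspondence `z` of degree `r` from `T` to `X`, acting by `z_*(a) = q_*([z] ∪ p^*(a))` (Lemma 1.8,
L62–L66: `z_* : H^{i−2r}_l(T)(−r) → Hⁱ_l(X)`): «Obviously `z_*` maps `H^{i−2r}_l(T)(−r)` into
`F^r_b Hⁱ_l(X)`» (there `H^{i−2r}_l(T)` is a semisimple Tate structure, `= F^0_b`).  The principle: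
a linear map intertwining the twisted Frobenii carries effective semisimple Tate substructures to
effective semisimple Tate substructures, shifting `r` by the twist.

For the tree's abstract `E : GaloisWeilCohomology k K χ` over a finite field `k`
(`E.frobIntegralPart X i r = F^r_b Hⁱ(X)`, `E.IsEffectiveTwistSubspace`, `ϖ = E.frobenius X i = ρ(F)`,
`ϖ_r = (q⁻¹)^r • ϖ`; `Motives/GeneralizedTateConjecture`) this file proves:

* §1 **transport**: a `K`-linear `T : Hⁱ(X) → Hʲ(Y)` with `ϖ_s ∘ T = T ∘ ϖ_r` maps effective-twist
  subspaces for `r` to effective-twist subspaces for `s` and `F^r_b Hⁱ(X)` into `F^s_b Hʲ(Y)`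
  (`IsEffectiveTwistSubspace.map_of_comp_eq`, `map_frobIntegralPart_le_of_comp_eq`).
* §2 **pull-backs** `f* : Hⁱ(U) → Hⁱ(V)` (`U`, `V` smooth projective; `pullback_ρ`):
  `f*(F^r_b Hⁱ(U)) ⊆ F^r_b Hⁱ(V)` (`map_pullback_frobIntegralPart_le`, `pullback_mem_frobIntegralPart`).
* §3 **cup product with a Galois-invariant class of twist `p`** (e.g. an algebraic class,
  `χ(φ) = q`): `F^r_b Hⁱ(X) ∪ (Hʲ(X)(p))^Γ ⊆ F^{r+p}_b H^{i+j}(X)` (`cup_mem_frobIntegralPart`,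
  `cup_algebraicClasses_mem_frobIntegralPart`; `cup_ρ`).
* §4 **Gysin push-forwards** `f₊ : Hᵉ(V) → Hᵈ(U)` (`χ(φ) = q`; the tree's `pushforward_ρ`:
  `f₊(gα) = χ(g)^{dim U − dim V} g f₊α`): `f₊(F^r_b Hᵉ(V)) ⊆ F^s_b Hᵈ(U)` for `r + dim U = s + dim V`
  (`map_pushforward_frobIntegralPart_le`, `pushforward_mem_frobIntegralPart`).
* §5 **algebraic correspondences** (Lemma 1.9's «obviously»): for `z ∈ H^{m}(T × X)` invariant under
  the `c`-th Tate twist, `a ↦ q_*(p^*(a) ∪ z)` maps `F^r_b Hⁱ(T)` into `F^{r+c−dim T}_b` of its target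
  (`pushforward_cup_pullback_mem_frobIntegralPart`).

HC is not touched.

## References

* [MilneRamachandran2006] J. S. Milne, N. Ramachandran, arXiv:math/0607483, §1 Rem. 1.4, Lemmas 1.8–1.9.
* [Kahn2020] B. Kahn, *Zeta and L-functions of varieties and motives*, CUP (2020), §3.5.1 (`f_*` and
  its Tate twist).
* [Tate1994] J. Tate, *Conjectures on algebraic cycles in ℓ-adic cohomology*, §1 (equivariance).

## Provenance

Lane `lit-hodgefound` (summit `HodgeConjecture`, Track 2 foundations library, Layer B: motives),
seat `lit-hodgefound-p29` (literature-prover, generation 39, row g39-#12).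
-/

noncomputable section

open Polynomial CategoryTheory MonoidalCategory CartesianMonoidalCategory

universe u v

namespace Literature.AlgebraicGeometry.Motives

namespace GaloisWeilCohomology

variable {k : Type u} [Field k] [Finite k] {K : Type v} [Field K] [CharZero K]
  {χ : Field.absoluteGaloisGroup k →* Kˣ} (E : GaloisWeilCohomology k K χ)

omit [Finite k] [CharZero K] in
/-- A linear map intertwining `f` and `g` intertwines polynomials in them:
`g ∘ T = T ∘ f ⟹ P(g) ∘ T = T ∘ P(f)`. [folklore] -/
private theorem aeval_comp_eq_comp_aeval {V W : Type*} [AddCommGroup V] [Module K V]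
    [AddCommGroup W] [Module K W] {f : Module.End K V} {g : Module.End K W} {T : V →ₗ[K] W}
    (h : g ∘ₗ T = T ∘ₗ f) (P : K[X]) : aeval g P ∘ₗ T = T ∘ₗ aeval f P := by
  induction P using Polynomial.induction_on' with
  | add P Q hP hQ => rw [map_add, map_add, LinearMap.add_comp, LinearMap.comp_add, hP, hQ]
  | monomial n a =>
    rw [aeval_monomial, aeval_monomial, ← Algebra.smul_def, ← Algebra.smul_def,
      LinearMap.smul_comp, LinearMap.comp_smul]
    congr 1
    exact Module.End.commute_pow_left_of_commute h n

/-! ### §1 Transport along a map intertwining the twisted Frobenii -/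

variable {E} in
/-- **A map `T : Hⁱ(X) → Hʲ(Y)` with `ϖ_s ∘ T = T ∘ ϖ_r` carries effective-twist subspaces (for `r`)
to effective-twist subspaces (for `s`)**: `T V` is `ϖ`-stable (`ϖ T v = q^s T(ϖ_r v)`) and the same
monic integer polynomial kills `ϖ_s` on it.  Rem. 1.4 / Lemma 1.9 («obviously `z_*` maps … into
`F^r_b`»). [cite: MilneRamachandran2006, §1 Rem. 1.4 and Lemma 1.9] -/
theorem IsEffectiveTwistSubspace.map_of_comp_eq {X Y : SchemeOver k} {i j r s : ℕ}
    {T : E.obj X i →ₗ[K] E.obj Y j}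
    (hT : (((Nat.card k : K)⁻¹ ^ s) • E.frobenius Y j) ∘ₗ T =
      T ∘ₗ (((Nat.card k : K)⁻¹ ^ r) • E.frobenius X i))
    {V : Submodule K (E.obj X i)} (hV : E.IsEffectiveTwistSubspace X i r V) :
    E.IsEffectiveTwistSubspace Y j s (V.map T) := by
  obtain ⟨hst, Q, hQm, hQs, hQ⟩ := hV
  have hq : ((Nat.card k : K)⁻¹ ^ s) ≠ 0 :=
    pow_ne_zero _ (inv_ne_zero (by exact_mod_cast Nat.card_pos.ne'))
  refine ⟨fun y hy ↦ ?_, ⟨Q, hQm, hQs, fun y hy ↦ ?_⟩⟩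
  · obtain ⟨v, hv, rfl⟩ := Submodule.mem_map.mp hy
    have h := LinearMap.congr_fun hT v
    simp only [LinearMap.comp_apply, LinearMap.smul_apply, map_smul] at h
    -- `ϖ (T v) = (q⁻¹)^{-s} (q⁻¹)^r T (ϖ v)`
    have h' : E.frobenius Y j (T v) =
        ((Nat.card k : K)⁻¹ ^ s)⁻¹ • ((Nat.card k : K)⁻¹ ^ r) • T (E.frobenius X i v) := by
      rw [← h, smul_smul, inv_mul_cancel₀ hq, one_smul]
    rw [h']
    exact Submodule.smul_mem _ _ (Submodule.smul_mem _ _ (Submodule.mem_map_of_mem (hst v hv)))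
  · obtain ⟨v, hv, rfl⟩ := Submodule.mem_map.mp hy
    have h := LinearMap.congr_fun (aeval_comp_eq_comp_aeval hT (Q.map (Int.castRingHom K))) v
    simp only [LinearMap.comp_apply] at h
    rw [h, hQ v hv, map_zero]

/-- **`T(F^r_b Hⁱ(X)) ⊆ F^s_b Hʲ(Y)` for `T` with `ϖ_s ∘ T = T ∘ ϖ_r`.**
[cite: MilneRamachandran2006, §1 Rem. 1.4 and Lemma 1.9] -/
theorem map_frobIntegralPart_le_of_comp_eq {X Y : SchemeOver k} {i j r s : ℕ}
    {T : E.obj X i →ₗ[K] E.obj Y j}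
    (hT : (((Nat.card k : K)⁻¹ ^ s) • E.frobenius Y j) ∘ₗ T =
      T ∘ₗ (((Nat.card k : K)⁻¹ ^ r) • E.frobenius X i)) :
    (E.frobIntegralPart X i r).map T ≤ E.frobIntegralPart Y j s := by
  unfold frobIntegralPart
  rw [Submodule.map_iSup]
  refine iSup_le fun V ↦ ?_
  rw [Submodule.map_iSup]
  exact iSup_le fun hV ↦ E.le_frobIntegralPart (hV.map_of_comp_eq hT)

/-- Pointwise form. [cite: MilneRamachandran2006, §1 Rem. 1.4 and Lemma 1.9] -/
theorem mem_frobIntegralPart_of_comp_eq {X Y : SchemeOver k} {i j r s : ℕ}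
    {T : E.obj X i →ₗ[K] E.obj Y j}
    (hT : (((Nat.card k : K)⁻¹ ^ s) • E.frobenius Y j) ∘ₗ T =
      T ∘ₗ (((Nat.card k : K)⁻¹ ^ r) • E.frobenius X i))
    {x : E.obj X i} (hx : x ∈ E.frobIntegralPart X i r) : T x ∈ E.frobIntegralPart Y j s :=
  E.map_frobIntegralPart_le_of_comp_eq hT (Submodule.mem_map_of_mem hx)

/-! ### §2 Pull-backs -/

variable {N M n : ℕ} {V U X : SchemeOver k}

/-- `ϖ_r ∘ f* = f* ∘ ϖ_r` (`pullback_ρ`: pull-backs are Galois equivariant).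
[cite: Tate1994, §1] [cite: MilneRamachandran2006, §1 Rem. 1.4] -/
theorem smul_frobenius_comp_pullback (hV : IsSmoothProjective N V) (hU : IsSmoothProjective M U)
    (f : V ⟶ U) (i r : ℕ) :
    (((Nat.card k : K)⁻¹ ^ r) • E.frobenius V i) ∘ₗ E.pullback f i =
      E.pullback f i ∘ₗ (((Nat.card k : K)⁻¹ ^ r) • E.frobenius U i) := by
  rw [LinearMap.smul_comp, LinearMap.comp_smul, frobenius, frobenius, E.pullback_ρ hV hU f i]

/-- **`f*(F^r_b Hⁱ(U)) ⊆ F^r_b Hⁱ(V)`** for `f : V ⟶ U` between smooth projective varieties.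
[cite: MilneRamachandran2006, §1 Rem. 1.4 and Lemma 1.9] [cite: Tate1994, §1] -/
theorem map_pullback_frobIntegralPart_le (hV : IsSmoothProjective N V) (hU : IsSmoothProjective M U)
    (f : V ⟶ U) (i r : ℕ) :
    (E.frobIntegralPart U i r).map (E.pullback f i) ≤ E.frobIntegralPart V i r :=
  E.map_frobIntegralPart_le_of_comp_eq (E.smul_frobenius_comp_pullback hV hU f i r)

/-- Pointwise: `x ∈ F^r_b Hⁱ(U) → f* x ∈ F^r_b Hⁱ(V)`. [cite: MilneRamachandran2006, §1 Rem. 1.4] [cite: Tate1994, §1] -/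
theorem pullback_mem_frobIntegralPart (hV : IsSmoothProjective N V) (hU : IsSmoothProjective M U)
    (f : V ⟶ U) {i r : ℕ} {x : E.obj U i} (hx : x ∈ E.frobIntegralPart U i r) :
    E.pullback f i x ∈ E.frobIntegralPart V i r :=
  E.map_pullback_frobIntegralPart_le hV hU f i r (Submodule.mem_map_of_mem hx)

/-! ### §3 Cup product with a Galois-invariant twisted class -/

/-- **`ϖ z = q^p z` for a class invariant under the `p`-th Tate twist** (`χ(φ) = q`: `χ(F)^p ρ(F) z = z`
with `χ(F) = q⁻¹`). [cite: Tate1994, §1] [cite: MilneRamachandran2006, §1.1] -/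
theorem frobenius_apply_of_mem_invariants (hχ : ((χ (arithFrob k) : Kˣ) : K) = Nat.card k)
    {j : ℕ} {p : ℕ} {z : E.obj X j} (hz : z ∈ (E.ρTwist X j p).invariants) :
    E.frobenius X j z = (((Nat.card k : K)⁻¹ ^ p))⁻¹ • z := by
  have hq : ((Nat.card k : K)⁻¹ ^ p) ≠ 0 :=
    pow_ne_zero _ (inv_ne_zero (by exact_mod_cast Nat.card_pos.ne'))
  have h := hz (geomFrob k)
  rw [ρTwist_apply, coe_χ_geomFrob hχ, zpow_natCast] at h
  rw [frobenius_apply, ← h, smul_smul, inv_mul_cancel₀ hq, one_smul, h]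

/-- `ϖ_{r+p} ∘ (· ∪ z) = (· ∪ z) ∘ ϖ_r` for `z` invariant under the `p`-th twist (`cup_ρ`; `χ(φ) = q`).
[cite: Tate1994, §1] [cite: MilneRamachandran2006, §1 Rem. 1.4] -/
theorem smul_frobenius_comp_cup_flip (hχ : ((χ (arithFrob k) : Kˣ) : K) = Nat.card k)
    (hX : IsSmoothProjective n X) {i j m : ℕ} (h : i + j = m) (r : ℕ) {p : ℕ} {z : E.obj X j}
    (hz : z ∈ (E.ρTwist X j p).invariants) :
    (((Nat.card k : K)⁻¹ ^ (r + p)) • E.frobenius X m) ∘ₗ (E.cup h).flip z =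
      (E.cup h).flip z ∘ₗ (((Nat.card k : K)⁻¹ ^ r) • E.frobenius X i) := by
  have hq : ((Nat.card k : K)⁻¹ ^ p) ≠ 0 :=
    pow_ne_zero _ (inv_ne_zero (by exact_mod_cast Nat.card_pos.ne'))
  ext a
  simp only [LinearMap.comp_apply, LinearMap.smul_apply, LinearMap.flip_apply, map_smul,
    LinearMap.smul_apply]
  rw [frobenius_apply, E.cup_ρ hX h (geomFrob k), ← frobenius_apply, ← frobenius_apply,
    E.frobenius_apply_of_mem_invariants hχ hz, map_smul, smul_smul, pow_add, mul_assoc,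
    mul_inv_cancel₀ hq, mul_one]

/-- **`F^r_b Hⁱ(X) ∪ z ⊆ F^{r+p}_b H^{i+j}(X)` for a class `z ∈ Hʲ(X)` invariant under the `p`-th Tate
twist** (`X` smooth projective, `χ(φ) = q`): cupping with an invariant class of twist `p` shifts the
effective-twist filtration by `p`. [cite: MilneRamachandran2006, §1 Rem. 1.4 and Lemma 1.9] [cite: Tate1994, §1] -/
theorem cup_mem_frobIntegralPart (hχ : ((χ (arithFrob k) : Kˣ) : K) = Nat.card k)
    (hX : IsSmoothProjective n X) {i j m : ℕ} (h : i + j = m) {r p : ℕ} {a : E.obj X i}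
    (ha : a ∈ E.frobIntegralPart X i r) {z : E.obj X j} (hz : z ∈ (E.ρTwist X j p).invariants) :
    E.cup h a z ∈ E.frobIntegralPart X m (r + p) := by
  have := E.mem_frobIntegralPart_of_comp_eq (E.smul_frobenius_comp_cup_flip hχ hX h r hz) ha
  simpa only [LinearMap.flip_apply] using this

/-- **`F^r_b Hⁱ(X) ∪ K·Aᵖ(X) ⊆ F^{r+p}_b H^{i+2p}(X)`**: cupping with an algebraic class of codimension
`p` (Galois invariant in `H²ᵖ(X)(p)`). [cite: MilneRamachandran2006, §1 Rem. 1.4 and Lemma 1.9] [cite: Tate1994, §1] -/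
theorem cup_algebraicClasses_mem_frobIntegralPart (hχ : ((χ (arithFrob k) : Kˣ) : K) = Nat.card k)
    (hX : IsSmoothProjective n X) {i m : ℕ} {r p : ℕ} (h : i + 2 * p = m) {a : E.obj X i}
    (ha : a ∈ E.frobIntegralPart X i r) {z : E.obj X (2 * p)} (hz : z ∈ E.algebraicClasses X p) :
    E.cup h a z ∈ E.frobIntegralPart X m (r + p) :=
  E.cup_mem_frobIntegralPart hχ hX h ha (E.algebraicClasses_le_invariants hX p hz)

/-! ### §4 Gysin push-forwards -/

/-- **`ϖ_s ∘ f₊ = f₊ ∘ ϖ_r` for `r + dim U = s + dim V`** (`f : V ⟶ U`; the tree's `pushforward_ρ`: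
`f₊(gα) = χ(g)^{dim U − dim V} g (f₊α)`, with `χ(F) = q⁻¹`).
[cite: Kahn2020, §3.5.1] [cite: Tate1994, §1] -/
theorem smul_frobenius_comp_pushforward (hχ : ((χ (arithFrob k) : Kˣ) : K) = Nat.card k)
    (hV : IsSmoothProjective N V) (hU : IsSmoothProjective M U) (f : V ⟶ U) {e d c : ℕ}
    (he : e + c = 2 * N) (hd : d + c = 2 * M) {r s : ℕ} (hrs : r + M = s + N) :
    (((Nat.card k : K)⁻¹ ^ s) • E.frobenius U d) ∘ₗ E.pushforward (N := N) hU f he hd =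
      E.pushforward (N := N) hU f he hd ∘ₗ (((Nat.card k : K)⁻¹ ^ r) • E.frobenius V e) := by
  have hq : ((Nat.card k : K)⁻¹) ≠ 0 := inv_ne_zero (by exact_mod_cast Nat.card_pos.ne')
  ext α
  simp only [LinearMap.comp_apply, LinearMap.smul_apply, map_smul]
  rw [frobenius_apply, frobenius_apply, E.pushforward_ρ hV hU f he hd (geomFrob k) α,
    coe_χ_geomFrob hχ, smul_smul]
  congr 1
  rw [← zpow_natCast, ← zpow_natCast, ← zpow_add₀ hq]
  congr 1
  omega

/-- **`f₊(F^r_b Hᵉ(V)) ⊆ F^s_b Hᵈ(U)` for `r + dim U = s + dim V`** (`f : V ⟶ U` of smooth projective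
varieties, `e + c = 2 dim V`, `d + c = 2 dim U`; `χ(φ) = q`): the Gysin map lands in the twist by
`dim U − dim V`. [cite: MilneRamachandran2006, §1 Rem. 1.4 and Lemma 1.9] [cite: Kahn2020, §3.5.1] -/
theorem map_pushforward_frobIntegralPart_le (hχ : ((χ (arithFrob k) : Kˣ) : K) = Nat.card k)
    (hV : IsSmoothProjective N V) (hU : IsSmoothProjective M U) (f : V ⟶ U) {e d c : ℕ}
    (he : e + c = 2 * N) (hd : d + c = 2 * M) {r s : ℕ} (hrs : r + M = s + N) :
    (E.frobIntegralPart V e r).map (E.pushforward (N := N) hU f he hd) ≤ E.frobIntegralPart U d s :=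
  E.map_frobIntegralPart_le_of_comp_eq (E.smul_frobenius_comp_pushforward hχ hV hU f he hd hrs)

/-- Pointwise: `x ∈ F^r_b Hᵉ(V) → f₊ x ∈ F^s_b Hᵈ(U)` (`r + dim U = s + dim V`).
[cite: MilneRamachandran2006, §1 Rem. 1.4 and Lemma 1.9] [cite: Kahn2020, §3.5.1] -/
theorem pushforward_mem_frobIntegralPart (hχ : ((χ (arithFrob k) : Kˣ) : K) = Nat.card k)
    (hV : IsSmoothProjective N V) (hU : IsSmoothProjective M U) (f : V ⟶ U) {e d c : ℕ}
    (he : e + c = 2 * N) (hd : d + c = 2 * M) {r s : ℕ} (hrs : r + M = s + N) {x : E.obj V e}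
    (hx : x ∈ E.frobIntegralPart V e r) :
    E.pushforward (N := N) hU f he hd x ∈ E.frobIntegralPart U d s :=
  E.map_pushforward_frobIntegralPart_le hχ hV hU f he hd hrs (Submodule.mem_map_of_mem hx)

/-! ### §5 Algebraic correspondences (Lemma 1.9: «obviously `z_*` maps … into `F^r_b`») -/

/-- **`q_*(p^*(a) ∪ z) ∈ F_b` for `a ∈ F_b`**: for smooth projective `T` (dimension `N`) and `Y`
(dimension `M`), their product `T × Y` (dimension `N + M`, the tree's `IsSmoothProjective.tensor_holds`),
a class `z ∈ Hʲ(T × Y)` invariant under the `c`-th Tate twist (e.g. the class of an algebraic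
correspondence, `j = 2c`), and `a ∈ F^r_b Hⁱ(T)`: the class `q_*(p^*(a) ∪ z) ∈ Hᵈ(Y)` lies in
`F^s_b Hᵈ(Y)` whenever `r + c + M = s + (N + M)`, i.e. `s = r + c − N` (Lemma 1.8: a correspondence of
degree `c − N` maps `H^{i}(T)` to `H^{i + 2(c − N)}(Y)`; Lemma 1.9: «obviously `z_*` maps
`H^{i−2r}_l(T)(−r)` into `F^r_b Hⁱ_l(X)`»).  Degrees: `i + j = m`, `m + c' = 2(N + M)`, `d + c' = 2M`.
[cite: MilneRamachandran2006, §1 Lemmas 1.8–1.9] [cite: Kahn2020, §3.5.1] -/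
theorem pushforward_cup_pullback_mem_frobIntegralPart (hχ : ((χ (arithFrob k) : Kˣ) : K) = Nat.card k)
    {T Y : SchemeOver k} (hT : IsSmoothProjective N T) (hY : IsSmoothProjective M Y)
    {i j m c' d : ℕ} (hij : i + j = m) (hm : m + c' = 2 * (N + M)) (hd : d + c' = 2 * M)
    {r c s : ℕ} (hs : r + c + M = s + (N + M)) {a : E.obj T i} (ha : a ∈ E.frobIntegralPart T i r)
    {z : E.obj (T ⊗ Y) j} (hz : z ∈ (E.ρTwist (T ⊗ Y) j c).invariants) :
    E.pushforward (N := N + M) hY (snd T Y) hm hd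
        (E.cup hij (E.pullback (fst T Y) i a) z) ∈ E.frobIntegralPart Y d s := by
  have hTY := IsSmoothProjective.tensor_holds hT hY
  refine E.pushforward_mem_frobIntegralPart hχ hTY hY (snd T Y) hm hd hs ?_
  exact E.cup_mem_frobIntegralPart hχ hTY hij (E.pullback_mem_frobIntegralPart hTY hT (fst T Y) ha) hz

end GaloisWeilCohomology

end Literature.AlgebraicGeometry.Motives

end
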